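import Literature.MathematicalPhysics.QuantumFieldTheory.Balaban1983to89.Beta.RemainderConstAllScales
import Literature.MathematicalPhysics.QuantumFieldTheory.Balaban1983to89.Beta.BalabanStepJetsSucc

/-!
# `Balaban1983to89.Beta.HessKerDressedCauchy` — road A2 (all-scales / Cauchy form) FOR THE WALL'S DRESSED FAMILY:
# the END instance over `BalabanStepJetsSucc.JsBalOf`, from pointwise all-scales data on the UNDRESSED primitives,
# and «the wall ⟺ the exact identification of the telescoped limit» modulo that data
# (asymptotic lane asym1, gen 12, v1; CONSTANTS half of the template, bookkeeping only)

HONEST FRAMING (cell contract, verbatim): «discharging `BetaPertH` makes Bałaban's UV stability UNCONDITIONAL — a real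
constructive-QFT result; it is NOT the continuum limit and NOT the Clay problem.»  THIS MODULE is [folklore] real analysis on `ℤ^D`
(additivity of the axial-gauge dressing, the tree's Lipschitz lemmas applied between two FINITE levels, Cesàro); it formalises NO
statement printed in Bałaban's papers, cites none as a hypothesis, mints no `Prop` fact, instantiates NO binder of the wall at a value
(RULING (R18-3); referee W-R556: the colour weights `cE, cVH, cΛ`, the tables `W j` and their localisation data stay UNIVERSALLY BOUND,
no `UNITS` numeral is touched) and DISCHARGES NOTHING of it.  NOT summit progress.

ABSOLUTE RULE (cell, verbatim): «No internally-minted statement may enter as a cited fact. Every hypothesis is either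
kernel-proved in this package or a verbatim quotation of a PUBLISHED theorem with page reference. The manuscript(s) under
audit are NOT citable for their own disputed steps — they are the thing under adjudication; programme-internal
(2001/route/tribunal) claims are never citable.»  Every theorem below is kernel-proved from explicit, abstract hypotheses on
matrix-fibred kernels; the six (CONV-C-Cauchy) data binders of §2, §4, §5 are HYPOTHESIS SHAPES with free constants, never asserted, and
nothing here says that Bałaban's objects satisfy them (located, NOT in print: O-asym1-1 / O-an2-2).

WHY THIS LEAF.  The wall (WALL v2.18) is the literal `OneStepKernelFamily.D1Drift Lc (BalabanStepJetsSucc.JsBalOf hLc cE cVH cΛ W Cw δw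
hδw hW) N μ ν := ∃ A, OneLoopDrift (stepBal N Lc) A (j ↦ secondMoment (TbalOf Lc JsBal j) μ ν)`, and the lead's verdict records «no END
instance over `JsBalOf`».  Row an2 (gen 10) landed the dressed family `JsBalOf = fun j ↦ AxialDressing.dress (JsBal0Of … j)` together with
its member-by-member closed form `TbalOf_JsBalOf : TbalOf Lc JsBal j = hessKer (Π·𝔎_j·Π) (V^Π_{𝔎_j} S_j) (W j)` (`𝔎_j = KInvStep Lc j` the
decimated composite resolvent, `Π·Π` = `axDressK Lc`, `V^Π` = `axVertexOfK`).  The asym1 chain's Cauchy-form END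
(`HessKerSchurCauchy` §3/§5, `RemainderConstAllScales` §5) is stated for the UNDRESSED shape `hessKer K (vertexOfK K N S) W` with ONE
kernel in both slots; the wall's family has `Π𝔎Π` in the A-slot and the undressed `𝔎` inside the dressed vertex.  This leaf closes
that bookkeeping gap: the dressing is ADDITIVE and has LEVEL-INDEPENDENT operator constants (`AxialDressing.cAx`, `cN'`), so all-scales
deviations of the undressed primitives pass through it with the same rate `θ` — whence the END instance over `JsBalOf` itself, in road
A2's currency (no limit object among the hypotheses; the β-limit SUPPLIED by telescoping, `LimitRate.limKernelOf`).

CONTENT (all [folklore]; NO `def`, NO `Prop` mirror — every constant is written out as an explicit polynomial in the supplier constants).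
* §1 ADDITIVITY OF THE DRESSING: `legAx₂_sub`, `legAx₁_sub`, `axDressK_sub : Π(A − B)Π = ΠAΠ − ΠBΠ`, `coProj_sub` (stencil families);
  transport of deviations `decays_axDressK_sub` (`Decays (A − B) C δ ⇒ Decays (ΠAΠ − ΠBΠ) (cAx²C) δ`), `locStencil_coProj_sub`.
* §2 GENERIC `d`, dressing level `N ≥ 1`: for families `K_k, S_k, W_k` with pointwise `k`-UNIFORM bounds `Decays (K k) C δK`,
  `LocStencil (S k) Cs δS`, `VertexFamily₂ (W k) N Cw δW` and ALL-SCALES deviations `Decays (K(k+j) − K k) (c_K θ^k) δK`, … , at any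
  `0 < R < δK`, `R/2 < δS`, `R < δW`: the family `k ↦ hessKer (Π K_k Π) (V^Π_{K_k} S_k) W_k` (= `AxialDressing.TbalOf_dress`'s shape; rewritten
  through `AxialDressing.vertexOfK_coProj_eq` as `hessKer (ΠK_kΠ) (vertexOfK K_k N (Πᵀ S_k)) W_k`) has (UD) (`uniformDecay_hessKer_dress_of_pointwise`,
  constant `hessW B_A B_V B_W`) and `AllScalesRate` (`allScalesRate_hessKer_dress_of_pointwise`, the tree's 8-slot `HessKerSchur.lipW` with
  A-slots `|Fib d|·cAx²·C·Zl(δK−R)` / `|Fib d|·cAx²·c_K·Zl(δK−R)`, V-slot through the UNDRESSED `K`-column and the `Πᵀ`-dressed stencils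
  `|Fib d|²·cN'·Cs·Zl(δS−R/2)²`, W-slot `|Fib d|²·Cw·Zl(δW−R)²`) at rate `R·N`, NO θ-range; hence `AllScalesSeq` of its second moments with
  `κ = betaPrime510 (d+1) (lipW …) (R·N)` (asym2's `allScalesSeq_secondMoment` BY NAME) and `GeomRate` to `secondMoment (limKernelOf …)` with the
  SAME `c₀ = κ` (`0 ≤ θ < 1`).
* §3 SEQUENCE ALGEBRA (any real sequence `b`, any slope `s`): `oneLoopDrift_iff_lim_eq` — under `AllScalesSeq b κ θ`, `0 ≤ θ < 1`:
  `(∃ A, OneLoopDrift s A b) ↔ CauchyRate.lim b = s` ((⇒) Cesàro `CauchyRate.lim_eq_of_drift`; (⇐) `AllScalesSeq.geomRate` + `GeomRate.drift`,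
  `A = κ/(1−θ)`); `pos_of_ge` — `m ≤ b k₀`, `κθ^{k₀} < m ⇒ 0 < b k` for all `k ≥ k₀` (`AllScalesSeq.tailDrop`).
* §4 `d = 3`: `allScalesSeq_secondMoment_TbalOf_dress` (ANY jet data `Js`, `TbalOf_dress` BY NAME), `d1Drift_iff_lim_eq` (ANY `Js`:
  `D1Drift Lc Js N μ ν ↔ CauchyRate.lim (β⁰) = stepBal N Lc` given an all-scales bound of `β⁰_j = secondMoment (TbalOf Lc Js j) μ ν`); and
  THE INSTANCE `TbalOf Lc (JsBalOf hLc cE cVH cΛ W Cw δw hδw hW)` (`TbalOf_JsBalOf` BY NAME): `allScalesSeq_/geomRate_secondMoment_TbalOf_JsBalOf`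
  (explicit `κ`), `lim_secondMoment_TbalOf_JsBalOf` (`CauchyRate.lim β⁰ = secondMoment (limKernelOf (TbalOf Lc JsBal)) μ ν`), then THE WALL:
  `d1Drift_JsBalOf_iff_lim_eq` (`D1Drift Lc JsBal N μ ν ↔ CauchyRate.lim β⁰ = stepBal N Lc` under (CONV-C-Cauchy), `0 ≤ θ < 1`) and
  `d1Drift_JsBalOf_of_limKernel_eq` ((CONV-C-Cauchy) + `hident : secondMoment (limKernelOf …) μ ν = stepBal N Lc ⇒ D1Drift Lc JsBal N μ ν`).
* §5 β-LEVEL over `JsBalOf` with `hβ0 : Sβ.β0 j = secondMoment (TbalOf Lc JsBal j) μ ν` and an all-scales bound `hall` (explicit `κ` from §4,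
  or any other supplier): `beta0_pos_of_ge_JsBalOf` (`β⁰_k > 0` for all `k ≥ k₀` from ONE certified `m ≤ β⁰_{k₀}` and the gap `κθ^{k₀} < m` —
  the lane's `betaBar_pos_of_ge k₀`), `beta0_pos_all_JsBalOf` (one-sided list up to `k₁`), asym2's (U)-derived sockets BY NAME
  `thm2Printed_JsBalOf_of_allScalesConst_cont` / `endpointExistence_JsBalOf_of_allScalesConst_cont`, and the JOINED END
  `thm2Printed_JsBalOf_of_pointwise_cont` (the six data binders + certified list + (D4) + the ONE numeric condition with the explicit `κ` + (C)
  ⟹ `B12.Thm2Printed Cn L`).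

UPSHOT FOR THE WALL (kernel-certified reading of road A2): modulo the six (CONV-C-Cauchy) data binders on the UNDRESSED finite-level
primitives — `j`-uniform pointwise decay of `KInvStep Lc j`, `(JsBal0Of … j).S`, `W j` and all-scales deviations with a rate `θ < 1` —
`D1Drift Lc JsBal N μ ν` is EQUIVALENT to the single real-number identity `CauchyRate.lim β⁰ = stepBal N Lc` (= `secondMoment (limKernelOf
(TbalOf Lc JsBal)) μ ν = stepBal N Lc`).  Road A2's «second half» (the exact identification of `b_∞`) is therefore not an add-on but the
entire residue of the wall once the rate data are in; and road B (`beta0_pos_*`, `thm2Printed_*`: positivity / Theorem 2 from certified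
finite-`k` values + one numeric gap) needs NO identification at all.  The budget line for the cap lanes is `κ · θ^{k₁} < m − r` with
`κ = betaPrime510 4 (lipW …8 explicit slots…) (R·Lc)`, `|Fib 3| = 8` (`LatticeConstantZl.card_Fib`, not imported), `Zl 4 (·)`
(`ExpKernelCalculus.Zl`), `cAx 3 Lc δK`, `cN' 3 Lc δS` (`AxialDressing`), `betaPrime510` (`B12Sec2to5`).

RELATION TO THE TREE (no duplication): an2's `AxialDressing` (`axDressK`, `axVertexOfK`, `decays_axDressK`, `locStencil_coProj`,
`vertexOfK_coProj_eq`, `TbalOf_dress`) and `BalabanStepJetsSucc` (`JsBal0Of`, `JsBalOf`, `TbalOf_JsBalOf`), the an1 projector algebra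
(`AxialProjector.axProj_sub`, `coProj_sub`), asym1's `HessKerSchur` / `HessKerSchurCauchy` bricks, asym2's `RemainderConstAllScales` sockets and
`RateCertificate` are USED BY NAME; nothing is re-proved.  New here: additivity / deviation transport of the dressing, the dressed-family
END with explicit constants, the END instance over `JsBalOf`, the drift ⟺ limit sequence lemma, and the wall ⟺ identification equivalence.  DOWNSTREAM of the wall (not imported, no overlap):
strat-b14's `AveragedAFCarrierJsBal` takes `hD : D1Drift Lc (JsBalOf …) N μ ν` as a BINDER and delivers the located [III] list; this leaf is
the UPSTREAM side — `d1Drift_JsBalOf_iff_lim_eq` / `d1Drift_JsBalOf_of_limKernel_eq` produce that `hD` from (CONV-C-Cauchy) + the identification, so the two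
compose by application.

WHAT IS NOT HERE (located, NOT in print, NOT claimed): any of the six data hypotheses for Bałaban's primitives (supplier rows an2 / an5 /
t4-ne2; Bałaban's papers print `η`-UNIFORM bounds, not scale-to-scale rates); the identification `b_∞ = stepBal N Lc` (road A2 second half /
road (1)); any numeric value of `C, c_•, δ_•, θ, R, m, k₀, k₁`; `betaPertH_holds`.  NOT continuum, NOT Clay.
-/

open Finset Filter
open scoped BigOperators
open Literature.MathematicalPhysics.QuantumFieldTheory.Balaban1983to89
open Literature.MathematicalPhysics.QuantumFieldTheory.Balaban1983to89.Beta
open B12Sec2to5 (l1 l1_nonneg Decay510 betaPrime510)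
open ExpKernelCalculus (MKer Decays VertexFamily₂ hessKer Zl)
open LimitRate (limKernelOf)
open HessKerSchur (ColW VertexFamilyW VertexFamily₂W hessW lipW LocStencilW colW_of_decays locStencilW_of_locStencil
  vertexFamily₂W_of_vertexFamily₂ uniformDecay_hessKer_halfV vertexFamilyW_vertexOfK)
open HessKerSchurCauchy (AllScalesRate allScalesRate_hessKer_halfV vertexFamilyW_vertexOfK_allScales)
open RemainderConstAllScales (AllScalesSeq allScalesSeq_secondMoment)
open RateCertificate (GeomRate CauchyRate)
open OneStepResolventKernel (Fib LocStencil JetData)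
open OneStepKernelFamily (vertexOfK KInvStep TbalOf D1Drift)
open AxialDressing (legAx₁ legAx₂ legAx₁_inl legAx₁_inr legAx₂_inl legAx₂_inr axDressK cAx cN' decays_axDressK locStencil_coProj
  axVertexOfK vertexOfK_coProj_eq dress TbalOf_dress)
open AxialProjector (axProj coProj)
open BalabanStepJetsSucc (JsBal0Of JsBalOf TbalOf_JsBalOf)

namespace Literature.MathematicalPhysics.QuantumFieldTheory.Balaban1983to89.Beta.HessKerDressedCauchy


/-! ## §1 The axial dressing is ADDITIVE: `Π`-legs, `Π K Π`, and the bond-slot `Πᵀ` pass through differences -/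

section Additive

variable {d : ℕ}

/-- [folklore] `Π` on the second leg is additive: `legAx₂ N (A − B) = legAx₂ N A − legAx₂ N B` (`AxialProjector.axProj_sub` on the
field components, identity on the multiplier components). -/
theorem legAx₂_sub (N : ℕ) (A B : MKer (d + 1) (Fib d)) : legAx₂ N (A - B) = legAx₂ N A - legAx₂ N B := by
  funext x y a b
  rcases b with β | m
  · show legAx₂ N (A - B) x y a (Sum.inl β) = legAx₂ N A x y a (Sum.inl β) - legAx₂ N B x y a (Sum.inl β)
    rw [legAx₂_inl, legAx₂_inl, legAx₂_inl,
      show (fun β' y' => (A - B) x y' a (Sum.inl β')) =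
          (fun β' y' => A x y' a (Sum.inl β')) - fun β' y' => B x y' a (Sum.inl β') from rfl,
      AxialProjector.axProj_sub]
    rfl
  · show legAx₂ N (A - B) x y a (Sum.inr m) = legAx₂ N A x y a (Sum.inr m) - legAx₂ N B x y a (Sum.inr m)
    rw [legAx₂_inr, legAx₂_inr, legAx₂_inr]
    rfl

/-- [folklore] `Π` on the first leg is additive. -/
theorem legAx₁_sub (N : ℕ) (A B : MKer (d + 1) (Fib d)) : legAx₁ N (A - B) = legAx₁ N A - legAx₁ N B := by
  funext x y a b
  rcases a with α | m
  · show legAx₁ N (A - B) x y (Sum.inl α) b = legAx₁ N A x y (Sum.inl α) b - legAx₁ N B x y (Sum.inl α) b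
    rw [legAx₁_inl, legAx₁_inl, legAx₁_inl,
      show (fun α' x' => (A - B) x' y (Sum.inl α') b) =
          (fun α' x' => A x' y (Sum.inl α') b) - fun α' x' => B x' y (Sum.inl α') b from rfl,
      AxialProjector.axProj_sub]
    rfl
  · show legAx₁ N (A - B) x y (Sum.inr m) b = legAx₁ N A x y (Sum.inr m) b - legAx₁ N B x y (Sum.inr m) b
    rw [legAx₁_inr, legAx₁_inr, legAx₁_inr]
    rfl

/-- [folklore] **`Π K Π` IS ADDITIVE**: `axDressK N (A − B) = axDressK N A − axDressK N B`. -/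
theorem axDressK_sub (N : ℕ) (A B : MKer (d + 1) (Fib d)) : axDressK N (A - B) = axDressK N A - axDressK N B := by
  unfold axDressK
  rw [legAx₂_sub, legAx₁_sub]

/-- [folklore] The bond-slot `Πᵀ` on `MKer`-valued stencil families is additive (`AxialProjector.coProj_sub`). -/
theorem coProj_sub (N : ℕ) (S T : Fin (d + 1) → (Fin (d + 1) → ℤ) → MKer (d + 1) (Fib d)) :
    coProj N (S - T) = coProj N S - coProj N T :=
  AxialProjector.coProj_sub N S T

/-- [folklore] **TRANSPORT OF A RESOLVENT DEVIATION THROUGH THE DRESSING**: `Decays (A − B) C δ ⇒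
Decays (Π A Π − Π B Π) (cAx²·C) δ` — SAME rate, level-independent constant `cAx d N δ` per leg (`AxialDressing.decays_axDressK`). -/
theorem decays_axDressK_sub {N : ℕ} (hN : 1 ≤ N) {A B : MKer (d + 1) (Fib d)} {C δ : ℝ} (h : Decays (A - B) C δ)
    (hδ : 0 ≤ δ) : Decays (axDressK N A - axDressK N B) (cAx d N δ * (cAx d N δ * C)) δ := by
  rw [← axDressK_sub]
  exact decays_axDressK hN h hδ

/-- [folklore] **TRANSPORT OF A STENCIL DEVIATION THROUGH THE BOND-SLOT DRESSING**: `LocStencil (S − T) Cs δ ⇒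
LocStencil (Πᵀ S − Πᵀ T) (cN'·Cs) δ` (`AxialDressing.locStencil_coProj`). -/
theorem locStencil_coProj_sub {N : ℕ} (hN : 1 ≤ N) {S T : Fin (d + 1) → (Fin (d + 1) → ℤ) → MKer (d + 1) (Fib d)}
    {Cs δ : ℝ} (h : LocStencil (S - T) Cs δ) (hδ : 0 ≤ δ) : LocStencil (coProj N S - coProj N T) (cN' d N δ * Cs) δ := by
  rw [← coProj_sub]
  exact locStencil_coProj hN h hδ

end Additive

/-! ## §2 The dressed family `k ↦ hessKer (Π·K_k·Π) (V^Π_{K_k} S_k) W_k` from POINTWISE all-scales data on the UNDRESSED primitives -/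

section Dressed

variable {d : ℕ}
variable {K : ℕ → MKer (d + 1) (Fib d)} {S : ℕ → Fin (d + 1) → (Fin (d + 1) → ℤ) → MKer (d + 1) (Fib d)}
  {W : ℕ → Fin (d + 1) → (Fin (d + 1) → ℤ) → Fin (d + 1) → (Fin (d + 1) → ℤ) → MKer (d + 1) (Fib d)}
  {R C cK δK Cs cS δS Cw cW δW θ : ℝ} {N : ℕ}

/-- [folklore] The `Π`-dressed chain-rule vertex is the chain-rule vertex through the UNDRESSED `K` of the `Πᵀ`-dressed stencils, as a
family: `(k ↦ V^Π_{K_k} S_k) = (k ↦ vertexOfK (K k) N (Πᵀ S_k))` (`AxialDressing.vertexOfK_coProj_eq`, entrywise). -/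
theorem axVertexOfK_eq_vertexOfK_coProj (hN : 1 ≤ N) (hK : ∀ k, Decays (K k) C δK) (hδK : 0 < δK)
    (hS : ∀ k, LocStencil (S k) Cs δS) (hδS : 0 ≤ δS) (k : ℕ) :
    axVertexOfK (K k) N (S k) = vertexOfK (K k) N (coProj N (S k)) :=
  funext fun μ => funext fun y => (vertexOfK_coProj_eq hN (hK k) hδK (hS k) hδS μ y).symm

/-- [folklore] **(UD) OF THE DRESSED FAMILY from pointwise `k`-uniform data on the undressed primitives**, at any target rate
`0 < R < δK`, `R/2 < δS`, `R < δW`, with the EXPLICIT constant `hessW B_A B_V B_W` (`B_A = |Fib d|·cAx²C·Zl(δK−R)`,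
`B_V = |Fib d|·C·Zl(δK−R) · |Fib d|²·cN'Cs·Zl(δS−R/2)²`, `B_W = |Fib d|²·Cw·Zl(δW−R)²`) at rate `R·N`. -/
theorem uniformDecay_hessKer_dress_of_pointwise (hN : 1 ≤ N) (hK : ∀ k, Decays (K k) C δK)
    (hS : ∀ k, LocStencil (S k) Cs δS) (hW : ∀ k, VertexFamily₂ (W k) N Cw δW)
    (hR : 0 < R) (hRK : R < δK) (hRS : R / 2 < δS) (hRW : R < δW) (μ ν : Fin (d + 1)) :
    LimitRate.UniformDecay (fun k => hessKer (axDressK N (K k)) (axVertexOfK (K k) N (S k)) (W k)) μ ν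
      (hessW ((Fintype.card (Fib d) : ℝ) * (cAx d N δK * (cAx d N δK * C)) * Zl (d + 1) (δK - R))
        ((Fintype.card (Fib d) : ℝ) * C * Zl (d + 1) (δK - R) * ((Fintype.card (Fib d) : ℝ) ^ 2 * (cN' d N δS * Cs) * Zl (d + 1) (δS - R / 2) ^ 2))
        ((Fintype.card (Fib d) : ℝ) ^ 2 * Cw * Zl (d + 1) (δW - R) ^ 2))
      (R * N) := by
  have hδK : 0 < δK := hR.trans hRK
  have hδS : 0 ≤ δS := by linarith
  have e : (fun k => hessKer (axDressK N (K k)) (axVertexOfK (K k) N (S k)) (W k)) =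
      fun k => hessKer (axDressK N (K k)) (vertexOfK (K k) N (coProj N (S k))) (W k) :=
    funext fun k => by rw [axVertexOfK_eq_vertexOfK_coProj hN hK hδK hS hδS k]
  rw [e]
  exact uniformDecay_hessKer_halfV (V := fun k => vertexOfK (K k) N (coProj N (S k)))
    (fun k => colW_of_decays (decays_axDressK hN (hK k) hδK.le) hRK)
    (fun k => vertexFamilyW_vertexOfK (colW_of_decays (hK k) hRK)
      (locStencilW_of_locStencil (locStencil_coProj hN (hS k) hδS) hRS) hR N)
    (fun k => vertexFamily₂W_of_vertexFamily₂ (hW k) hRW) hR.le μ ν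

/-- [folklore] **ALL-SCALES RATE OF THE DRESSED FAMILY from pointwise all-scales data on the UNDRESSED primitives**
(`Decays (K(k+j) − K k) (c_K θ^k) δK`, `LocStencil (S(k+j) − S k) (c_S θ^k) δS`, `VertexFamily₂ (W(k+j) − W k) N (c_W θ^k) δW`):
`AllScalesRate (k ↦ hessKer (Π K_k Π) (V^Π_{K_k} S_k) W_k) μ ν (lipW …) (R·N) θ` with the EXPLICIT 8-slot constant — the A-slots carry
`cAx d N δK` squared (one factor per `Π`-leg, `AxialDressing.decays_axDressK`), the V-slot the UNDRESSED `K`-column against the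
`Πᵀ`-dressed stencils (`cN' d N δS`, `AxialDressing.locStencil_coProj`), the W-slot is untouched; the lattice constant `Zl` is paid once per
primitive as in the tree's `_of_pointwise`.  The deviations pass through the dressing by §1 (`decays_axDressK_sub`,
`locStencil_coProj_sub`); then `HessKerSchurCauchy.allScalesRate_hessKer_halfV` with `vertexFamilyW_vertexOfK[_allScales]` at
`(K, Πᵀ S)`.  NO range of `θ`, NO limit object. -/
theorem allScalesRate_hessKer_dress_of_pointwise (hN : 1 ≤ N)
    (hK : ∀ k, Decays (K k) C δK) (hKall : ∀ k j, Decays (K (k + j) - K k) (cK * θ ^ k) δK)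
    (hS : ∀ k, LocStencil (S k) Cs δS) (hSall : ∀ k j, LocStencil (S (k + j) - S k) (cS * θ ^ k) δS)
    (hW : ∀ k, VertexFamily₂ (W k) N Cw δW) (hWall : ∀ k j, VertexFamily₂ (W (k + j) - W k) N (cW * θ ^ k) δW)
    (hR : 0 < R) (hRK : R < δK) (hRS : R / 2 < δS) (hRW : R < δW) (μ ν : Fin (d + 1)) :
    AllScalesRate (fun k => hessKer (axDressK N (K k)) (axVertexOfK (K k) N (S k)) (W k)) μ ν
      (lipW ((Fintype.card (Fib d) : ℝ) * (cAx d N δK * (cAx d N δK * C)) * Zl (d + 1) (δK - R))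
        ((Fintype.card (Fib d) : ℝ) * (cAx d N δK * (cAx d N δK * C)) * Zl (d + 1) (δK - R))
        ((Fintype.card (Fib d) : ℝ) * C * Zl (d + 1) (δK - R) * ((Fintype.card (Fib d) : ℝ) ^ 2 * (cN' d N δS * Cs) * Zl (d + 1) (δS - R / 2) ^ 2))
        ((Fintype.card (Fib d) : ℝ) * C * Zl (d + 1) (δK - R) * ((Fintype.card (Fib d) : ℝ) ^ 2 * (cN' d N δS * Cs) * Zl (d + 1) (δS - R / 2) ^ 2))
        ((Fintype.card (Fib d) : ℝ) ^ 2 * Cw * Zl (d + 1) (δW - R) ^ 2)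
        ((Fintype.card (Fib d) : ℝ) * (cAx d N δK * (cAx d N δK * cK)) * Zl (d + 1) (δK - R))
        ((Fintype.card (Fib d) : ℝ) * cK * Zl (d + 1) (δK - R) * ((Fintype.card (Fib d) : ℝ) ^ 2 * (cN' d N δS * Cs) * Zl (d + 1) (δS - R / 2) ^ 2) +
          (Fintype.card (Fib d) : ℝ) * C * Zl (d + 1) (δK - R) * ((Fintype.card (Fib d) : ℝ) ^ 2 * (cN' d N δS * cS) * Zl (d + 1) (δS - R / 2) ^ 2))
        ((Fintype.card (Fib d) : ℝ) ^ 2 * cW * Zl (d + 1) (δW - R) ^ 2))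
      (R * N) θ := by
  have hδK : 0 < δK := hR.trans hRK
  have hδS : 0 ≤ δS := by linarith
  have e : (fun k => hessKer (axDressK N (K k)) (axVertexOfK (K k) N (S k)) (W k)) =
      fun k => hessKer (axDressK N (K k)) (vertexOfK (K k) N (coProj N (S k))) (W k) :=
    funext fun k => by rw [axVertexOfK_eq_vertexOfK_coProj hN hK hδK hS hδS k]
  rw [e]
  -- the A-slot `Π K_k Π`: uniform bound and all-scales deviations (the dressing is additive, §1)
  have hA : ∀ k, ColW (axDressK N (K k)) R ((Fintype.card (Fib d) : ℝ) * (cAx d N δK * (cAx d N δK * C)) * Zl (d + 1) (δK - R)) :=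
    fun k => colW_of_decays (decays_axDressK hN (hK k) hδK.le) hRK
  have hAall : ∀ k j, ColW (axDressK N (K (k + j)) - axDressK N (K k)) R
      ((Fintype.card (Fib d) : ℝ) * (cAx d N δK * (cAx d N δK * cK)) * Zl (d + 1) (δK - R) * θ ^ k) := fun k j =>
    (colW_of_decays (decays_axDressK_sub hN (hKall k j) hδK.le) hRK).mono (le_of_eq (by ring))
  -- the V-slot: UNDRESSED `K`-columns against the `Πᵀ`-dressed stencils
  have hKW : ∀ k, ColW (K k) R ((Fintype.card (Fib d) : ℝ) * C * Zl (d + 1) (δK - R)) := fun k => colW_of_decays (hK k) hRK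
  have hKWall : ∀ k j, ColW (K (k + j) - K k) R ((Fintype.card (Fib d) : ℝ) * cK * Zl (d + 1) (δK - R) * θ ^ k) := fun k j =>
    (colW_of_decays (hKall k j) hRK).mono (le_of_eq (by ring))
  have hSW : ∀ k, LocStencilW (coProj N (S k)) (R / 2) ((Fintype.card (Fib d) : ℝ) ^ 2 * (cN' d N δS * Cs) * Zl (d + 1) (δS - R / 2) ^ 2) :=
    fun k => locStencilW_of_locStencil (locStencil_coProj hN (hS k) hδS) hRS
  have hSWall : ∀ k j, LocStencilW (coProj N (S (k + j)) - coProj N (S k)) (R / 2)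
      (((Fintype.card (Fib d) : ℝ) ^ 2 * (cN' d N δS * cS) * Zl (d + 1) (δS - R / 2) ^ 2) * θ ^ k) := fun k j =>
    (locStencilW_of_locStencil (locStencil_coProj_sub hN (hSall k j) hδS) hRS).mono (le_of_eq (by ring))
  have hV := fun k => vertexFamilyW_vertexOfK (hKW k) (hSW k) hR N
  have hVall := fun k j => vertexFamilyW_vertexOfK_allScales (S := fun k => coProj N (S k)) hKW hKWall hSW hSWall hR N k j
  -- the W-slot
  have hWW : ∀ k, VertexFamily₂W (W k) N R ((Fintype.card (Fib d) : ℝ) ^ 2 * Cw * Zl (d + 1) (δW - R) ^ 2) :=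
    fun k => vertexFamily₂W_of_vertexFamily₂ (hW k) hRW
  have hWWall : ∀ k j, VertexFamily₂W (W (k + j) - W k) N R ((Fintype.card (Fib d) : ℝ) ^ 2 * cW * Zl (d + 1) (δW - R) ^ 2 * θ ^ k) :=
    fun k j => (vertexFamily₂W_of_vertexFamily₂ (hWall k j) hRW).mono (le_of_eq (by ring))
  exact allScalesRate_hessKer_halfV (V := fun k => vertexOfK (K k) N (coProj N (S k))) hA hAall hV hVall hWW hWWall hR μ ν

/-- [folklore] **SCALAR ALL-SCALES END OF THE DRESSED FAMILY** (asym2's `RemainderConstAllScales.allScalesSeq_secondMoment` BY NAME):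
`AllScalesSeq (k ↦ secondMoment (hessKer (Π K_k Π) (V^Π_{K_k} S_k) W_k) μ ν) κ θ` with the EXPLICIT
`κ = betaPrime510 (d+1) (lipW …) (R·N)` — NO range of `θ`, NO limit object anywhere. -/
theorem allScalesSeq_secondMoment_hessKer_dress_of_pointwise (hN : 1 ≤ N)
    (hK : ∀ k, Decays (K k) C δK) (hKall : ∀ k j, Decays (K (k + j) - K k) (cK * θ ^ k) δK)
    (hS : ∀ k, LocStencil (S k) Cs δS) (hSall : ∀ k j, LocStencil (S (k + j) - S k) (cS * θ ^ k) δS)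
    (hW : ∀ k, VertexFamily₂ (W k) N Cw δW) (hWall : ∀ k j, VertexFamily₂ (W (k + j) - W k) N (cW * θ ^ k) δW)
    (hR : 0 < R) (hRK : R < δK) (hRS : R / 2 < δS) (hRW : R < δW) (μ ν : Fin (d + 1)) :
    AllScalesSeq (fun k => B12Beta.secondMoment (hessKer (axDressK N (K k)) (axVertexOfK (K k) N (S k)) (W k)) μ ν)
      (betaPrime510 (d + 1)
        (lipW ((Fintype.card (Fib d) : ℝ) * (cAx d N δK * (cAx d N δK * C)) * Zl (d + 1) (δK - R))
          ((Fintype.card (Fib d) : ℝ) * (cAx d N δK * (cAx d N δK * C)) * Zl (d + 1) (δK - R))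
          ((Fintype.card (Fib d) : ℝ) * C * Zl (d + 1) (δK - R) * ((Fintype.card (Fib d) : ℝ) ^ 2 * (cN' d N δS * Cs) * Zl (d + 1) (δS - R / 2) ^ 2))
          ((Fintype.card (Fib d) : ℝ) * C * Zl (d + 1) (δK - R) * ((Fintype.card (Fib d) : ℝ) ^ 2 * (cN' d N δS * Cs) * Zl (d + 1) (δS - R / 2) ^ 2))
          ((Fintype.card (Fib d) : ℝ) ^ 2 * Cw * Zl (d + 1) (δW - R) ^ 2)
          ((Fintype.card (Fib d) : ℝ) * (cAx d N δK * (cAx d N δK * cK)) * Zl (d + 1) (δK - R))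
          ((Fintype.card (Fib d) : ℝ) * cK * Zl (d + 1) (δK - R) * ((Fintype.card (Fib d) : ℝ) ^ 2 * (cN' d N δS * Cs) * Zl (d + 1) (δS - R / 2) ^ 2) +
            (Fintype.card (Fib d) : ℝ) * C * Zl (d + 1) (δK - R) * ((Fintype.card (Fib d) : ℝ) ^ 2 * (cN' d N δS * cS) * Zl (d + 1) (δS - R / 2) ^ 2))
          ((Fintype.card (Fib d) : ℝ) ^ 2 * cW * Zl (d + 1) (δW - R) ^ 2))
        (R * N)) θ := by
  have hRN : 0 < R * (N : ℝ) := mul_pos hR (by exact_mod_cast (show 0 < N by omega))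
  exact allScalesSeq_secondMoment (uniformDecay_hessKer_dress_of_pointwise hN hK hS hW hR hRK hRS hRW μ ν)
    (allScalesRate_hessKer_dress_of_pointwise hN hK hKall hS hSall hW hWall hR hRK hRS hRW μ ν) hRN hRN

/-- [folklore] **(SW1)-SHAPE END OF THE DRESSED FAMILY**: `GeomRate` of the second moments to the TELESCOPED limit kernel's second moment
`b_∞ = secondMoment (limKernelOf …) μ ν`, SAME `c₀ = κ` (`0 ≤ θ < 1`; `HessKerSchurCauchy.AllScalesRate.geomRate_secondMoment`). -/
theorem geomRate_secondMoment_hessKer_dress_of_pointwise (hN : 1 ≤ N)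
    (hK : ∀ k, Decays (K k) C δK) (hKall : ∀ k j, Decays (K (k + j) - K k) (cK * θ ^ k) δK)
    (hS : ∀ k, LocStencil (S k) Cs δS) (hSall : ∀ k j, LocStencil (S (k + j) - S k) (cS * θ ^ k) δS)
    (hW : ∀ k, VertexFamily₂ (W k) N Cw δW) (hWall : ∀ k j, VertexFamily₂ (W (k + j) - W k) N (cW * θ ^ k) δW)
    (hR : 0 < R) (hRK : R < δK) (hRS : R / 2 < δS) (hRW : R < δW) (hθ0 : 0 ≤ θ) (hθ1 : θ < 1) (μ ν : Fin (d + 1)) :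
    GeomRate (fun k => B12Beta.secondMoment (hessKer (axDressK N (K k)) (axVertexOfK (K k) N (S k)) (W k)) μ ν)
      (B12Beta.secondMoment (limKernelOf (fun k => hessKer (axDressK N (K k)) (axVertexOfK (K k) N (S k)) (W k))) μ ν)
      (betaPrime510 (d + 1)
        (lipW ((Fintype.card (Fib d) : ℝ) * (cAx d N δK * (cAx d N δK * C)) * Zl (d + 1) (δK - R))
          ((Fintype.card (Fib d) : ℝ) * (cAx d N δK * (cAx d N δK * C)) * Zl (d + 1) (δK - R))
          ((Fintype.card (Fib d) : ℝ) * C * Zl (d + 1) (δK - R) * ((Fintype.card (Fib d) : ℝ) ^ 2 * (cN' d N δS * Cs) * Zl (d + 1) (δS - R / 2) ^ 2))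
          ((Fintype.card (Fib d) : ℝ) * C * Zl (d + 1) (δK - R) * ((Fintype.card (Fib d) : ℝ) ^ 2 * (cN' d N δS * Cs) * Zl (d + 1) (δS - R / 2) ^ 2))
          ((Fintype.card (Fib d) : ℝ) ^ 2 * Cw * Zl (d + 1) (δW - R) ^ 2)
          ((Fintype.card (Fib d) : ℝ) * (cAx d N δK * (cAx d N δK * cK)) * Zl (d + 1) (δK - R))
          ((Fintype.card (Fib d) : ℝ) * cK * Zl (d + 1) (δK - R) * ((Fintype.card (Fib d) : ℝ) ^ 2 * (cN' d N δS * Cs) * Zl (d + 1) (δS - R / 2) ^ 2) +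
            (Fintype.card (Fib d) : ℝ) * C * Zl (d + 1) (δK - R) * ((Fintype.card (Fib d) : ℝ) ^ 2 * (cN' d N δS * cS) * Zl (d + 1) (δS - R / 2) ^ 2))
          ((Fintype.card (Fib d) : ℝ) ^ 2 * cW * Zl (d + 1) (δW - R) ^ 2))
        (R * N)) θ := by
  have hRN : 0 < R * (N : ℝ) := mul_pos hR (by exact_mod_cast (show 0 < N by omega))
  exact HessKerSchurCauchy.AllScalesRate.geomRate_secondMoment
    (uniformDecay_hessKer_dress_of_pointwise hN hK hS hW hR hRK hRS hRW μ ν)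
    (allScalesRate_hessKer_dress_of_pointwise hN hK hKall hS hSall hW hWall hR hRK hRS hRW μ ν) hRN hRN hθ0 hθ1

end Dressed

/-! ## §3 Sequence algebra: drift ⟺ identification of the limit, and tail positivity, under an all-scales bound -/

section Seq

variable {b : ℕ → ℝ} {κ θ : ℝ}

/-- [folklore] **UNDER AN ALL-SCALES BOUND, «ONE-LOOP DRIFT WITH SLOPE `s`» ⟺ «THE CONSTRUCTED LIMIT IS `s`»** (`0 ≤ θ < 1`):
(⇒) Cesàro, `RateCertificate.CauchyRate.lim_eq_of_drift`; (⇐) `AllScalesSeq.geomRate` (two-ended rate about `lim b`, SAME `κ`) and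
`RateCertificate.GeomRate.drift` (defect `κ/(1−θ)`).  Pure sequence algebra; `b`, `s` arbitrary. -/
theorem oneLoopDrift_iff_lim_eq (hall : AllScalesSeq b κ θ) (hθ0 : 0 ≤ θ) (hθ1 : θ < 1) (s : ℝ) :
    (∃ A : ℝ, Drift.OneLoopDrift s A b) ↔ CauchyRate.lim b = s :=
  ⟨fun ⟨_, hA⟩ => hall.cauchyRate.lim_eq_of_drift hθ1 hA, fun h => ⟨κ / (1 - θ), h ▸ (hall.geomRate hθ1).drift hθ0 hθ1⟩⟩

/-- [folklore] The defect made explicit: an all-scales bound gives the drift about the constructed limit with `A = κ/(1−θ)`. -/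
theorem oneLoopDrift_lim (hall : AllScalesSeq b κ θ) (hθ0 : 0 ≤ θ) (hθ1 : θ < 1) :
    Drift.OneLoopDrift (CauchyRate.lim b) (κ / (1 - θ)) b :=
  (hall.geomRate hθ1).drift hθ0 hθ1

/-- [folklore] **TAIL POSITIVITY FROM ONE CERTIFIED VALUE**: `m ≤ b k₀` and `κθ^{k₀} < m` give `0 < b k` for every `k ≥ k₀`
(`AllScalesSeq.tailDrop`: `b k₀ − κθ^{k₀} ≤ b k`).  No θ-range, no limit. -/
theorem pos_of_ge (hall : AllScalesSeq b κ θ) {k₀ : ℕ} {m : ℝ} (hm : m ≤ b k₀) (hgap : κ * θ ^ k₀ < m) :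
    ∀ k, k₀ ≤ k → 0 < b k := fun k hk => by
  linarith [hall.tailDrop k₀ k hk]

end Seq

/-! ## §4 Dimension four: the wall's one-step family `TbalOf Lc (fun j ↦ dress (Js j))` and THE INSTANCE `JsBalOf` -/

section WallDress

variable {Lc : ℕ} [NeZero Lc] {Js : ℕ → JetData 3 Lc} {R C cK δK Cs cS δS Cw cW δW θ : ℝ}

/-- [folklore] `1 ≤ Lc` from `[NeZero Lc]`. -/
theorem one_le_Lc : 1 ≤ Lc := Nat.one_le_iff_ne_zero.mpr (NeZero.ne Lc)

/-- [folklore] **SCALAR ALL-SCALES END FOR THE DRESSED STEP FAMILY OF ANY JET DATA** `Js : ℕ → JetData 3 Lc` (an2's `AxialDressing.TbalOf_dress`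
BY NAME; dressing level = blocking factor `Lc`): pointwise `j`-UNIFORM bounds and ALL-SCALES deviations WITH RATE `θ` of the UNDRESSED
primitives — the decimated composite resolvents `KInvStep Lc j`, the stencils `(Js j).S`, the tables `(Js j).W` — give
`AllScalesSeq (j ↦ secondMoment (TbalOf Lc (fun j ↦ dress (Js j)) j) μ ν) κ θ`, `κ = betaPrime510 4 (lipW …) (R·Lc)` EXPLICIT.  The six data
binders are HYPOTHESIS SHAPES ((CONV-C-Cauchy) of the lane memo: located, NOT in print), never asserted. -/
theorem allScalesSeq_secondMoment_TbalOf_dress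
    (hK : ∀ j, Decays (KInvStep (d := 3) Lc j) C δK)
    (hKall : ∀ k j, Decays (KInvStep (d := 3) Lc (k + j) - KInvStep (d := 3) Lc k) (cK * θ ^ k) δK)
    (hS : ∀ j, LocStencil (Js j).S Cs δS) (hSall : ∀ k j, LocStencil ((Js (k + j)).S - (Js k).S) (cS * θ ^ k) δS)
    (hW : ∀ j, VertexFamily₂ (Js j).W Lc Cw δW) (hWall : ∀ k j, VertexFamily₂ ((Js (k + j)).W - (Js k).W) Lc (cW * θ ^ k) δW)
    (hR : 0 < R) (hRK : R < δK) (hRS : R / 2 < δS) (hRW : R < δW) (μ ν : Fin 4) :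
    AllScalesSeq (fun j => B12Beta.secondMoment (TbalOf Lc (fun j => dress (Js j)) j) μ ν)
      (betaPrime510 4
        (lipW ((Fintype.card (Fib 3) : ℝ) * (cAx 3 Lc δK * (cAx 3 Lc δK * C)) * Zl 4 (δK - R))
          ((Fintype.card (Fib 3) : ℝ) * (cAx 3 Lc δK * (cAx 3 Lc δK * C)) * Zl 4 (δK - R))
          ((Fintype.card (Fib 3) : ℝ) * C * Zl 4 (δK - R) * ((Fintype.card (Fib 3) : ℝ) ^ 2 * (cN' 3 Lc δS * Cs) * Zl 4 (δS - R / 2) ^ 2))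
          ((Fintype.card (Fib 3) : ℝ) * C * Zl 4 (δK - R) * ((Fintype.card (Fib 3) : ℝ) ^ 2 * (cN' 3 Lc δS * Cs) * Zl 4 (δS - R / 2) ^ 2))
          ((Fintype.card (Fib 3) : ℝ) ^ 2 * Cw * Zl 4 (δW - R) ^ 2)
          ((Fintype.card (Fib 3) : ℝ) * (cAx 3 Lc δK * (cAx 3 Lc δK * cK)) * Zl 4 (δK - R))
          ((Fintype.card (Fib 3) : ℝ) * cK * Zl 4 (δK - R) * ((Fintype.card (Fib 3) : ℝ) ^ 2 * (cN' 3 Lc δS * Cs) * Zl 4 (δS - R / 2) ^ 2) +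
            (Fintype.card (Fib 3) : ℝ) * C * Zl 4 (δK - R) * ((Fintype.card (Fib 3) : ℝ) ^ 2 * (cN' 3 Lc δS * cS) * Zl 4 (δS - R / 2) ^ 2))
          ((Fintype.card (Fib 3) : ℝ) ^ 2 * cW * Zl 4 (δW - R) ^ 2))
        (R * Lc)) θ :=
  (allScalesSeq_secondMoment_hessKer_dress_of_pointwise (S := fun j => (Js j).S) (W := fun j => (Js j).W) one_le_Lc hK hKall hS
    hSall hW hWall hR hRK hRS hRW μ ν).congr fun j => by rw [TbalOf_dress]

/-- [folklore] **THE WALL ⟺ THE IDENTIFICATION for ANY jet data, modulo an all-scales bound of the coefficients** (however supplied —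
e.g. by `allScalesSeq_secondMoment_TbalOf_dress`, or by `RemainderConstAllScales.allScalesSeq_secondMoment_hessKer_operatorsW`):
`OneStepKernelFamily.D1Drift Lc Js N μ ν ↔ CauchyRate.lim (j ↦ secondMoment (TbalOf Lc Js j) μ ν) = B12Normalization.stepBal N Lc`. -/
theorem d1Drift_iff_lim_eq (Js : ℕ → JetData 3 Lc) {μ ν : Fin 4} {κ θ : ℝ}
    (hall : AllScalesSeq (fun j => B12Beta.secondMoment (TbalOf Lc Js j) μ ν) κ θ) (hθ0 : 0 ≤ θ) (hθ1 : θ < 1) (N : ℝ) :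
    D1Drift Lc Js N μ ν ↔ CauchyRate.lim (fun j => B12Beta.secondMoment (TbalOf Lc Js j) μ ν) = B12Normalization.stepBal N Lc :=
  oneLoopDrift_iff_lim_eq hall hθ0 hθ1 _

end WallDress

section Wall

variable {Lc : ℕ} [NeZero Lc] (hLc : 1 ≤ Lc) (cE cVH cΛ : ℝ)
  (W : ℕ → Fin (3 + 1) → (Fin (3 + 1) → ℤ) → Fin (3 + 1) → (Fin (3 + 1) → ℤ) → MKer (3 + 1) (Fib 3))
  (Cw' δw : ℕ → ℝ) (hδw : ∀ j, 0 < δw j) (hW' : ∀ j, VertexFamily₂ (W j) Lc (Cw' j) (δw j))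
  {R C cK δK Cs cS δS Cw cW δW θ : ℝ}

/-- [folklore] **THE END INSTANCE OVER `JsBalOf` — SCALAR ALL-SCALES FORM.**  For an2's literal of route (α),
`JsBalOf hLc cE cVH cΛ W Cw' δw hδw hW' = fun j ↦ dress (JsBal0Of … j)` (every colour weight `cE, cVH, cΛ`, every table `W j` and its
localisation data UNIVERSALLY BOUND — nothing pinned, nothing instantiated at values): pointwise `j`-UNIFORM bounds and ALL-SCALES deviations
with rate `θ` of the UNDRESSED primitives `KInvStep Lc j`, `(JsBal0Of … j).S`, `W j` give
`AllScalesSeq (j ↦ secondMoment (TbalOf Lc (JsBalOf …) j) μ ν) κ θ` with `κ = betaPrime510 4 (lipW …) (R·Lc)` EXPLICIT — NO range of `θ`,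
NO limit object (an2's `TbalOf_JsBalOf` BY NAME).  The six data binders (CONV-C-Cauchy) are NOT in print. -/
theorem allScalesSeq_secondMoment_TbalOf_JsBalOf
    (hK : ∀ j, Decays (KInvStep (d := 3) Lc j) C δK)
    (hKall : ∀ k j, Decays (KInvStep (d := 3) Lc (k + j) - KInvStep (d := 3) Lc k) (cK * θ ^ k) δK)
    (hS : ∀ j, LocStencil (JsBal0Of hLc cE cVH cΛ W Cw' δw hδw hW' j).S Cs δS)
    (hSall : ∀ k j, LocStencil ((JsBal0Of hLc cE cVH cΛ W Cw' δw hδw hW' (k + j)).S - (JsBal0Of hLc cE cVH cΛ W Cw' δw hδw hW' k).S) (cS * θ ^ k) δS)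
    (hW : ∀ j, VertexFamily₂ (W j) Lc Cw δW) (hWall : ∀ k j, VertexFamily₂ (W (k + j) - W k) Lc (cW * θ ^ k) δW)
    (hR : 0 < R) (hRK : R < δK) (hRS : R / 2 < δS) (hRW : R < δW) (μ ν : Fin 4) :
    AllScalesSeq (fun j => B12Beta.secondMoment (TbalOf Lc (JsBalOf hLc cE cVH cΛ W Cw' δw hδw hW') j) μ ν)
      (betaPrime510 4
        (lipW ((Fintype.card (Fib 3) : ℝ) * (cAx 3 Lc δK * (cAx 3 Lc δK * C)) * Zl 4 (δK - R))
          ((Fintype.card (Fib 3) : ℝ) * (cAx 3 Lc δK * (cAx 3 Lc δK * C)) * Zl 4 (δK - R))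
          ((Fintype.card (Fib 3) : ℝ) * C * Zl 4 (δK - R) * ((Fintype.card (Fib 3) : ℝ) ^ 2 * (cN' 3 Lc δS * Cs) * Zl 4 (δS - R / 2) ^ 2))
          ((Fintype.card (Fib 3) : ℝ) * C * Zl 4 (δK - R) * ((Fintype.card (Fib 3) : ℝ) ^ 2 * (cN' 3 Lc δS * Cs) * Zl 4 (δS - R / 2) ^ 2))
          ((Fintype.card (Fib 3) : ℝ) ^ 2 * Cw * Zl 4 (δW - R) ^ 2)
          ((Fintype.card (Fib 3) : ℝ) * (cAx 3 Lc δK * (cAx 3 Lc δK * cK)) * Zl 4 (δK - R))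
          ((Fintype.card (Fib 3) : ℝ) * cK * Zl 4 (δK - R) * ((Fintype.card (Fib 3) : ℝ) ^ 2 * (cN' 3 Lc δS * Cs) * Zl 4 (δS - R / 2) ^ 2) +
            (Fintype.card (Fib 3) : ℝ) * C * Zl 4 (δK - R) * ((Fintype.card (Fib 3) : ℝ) ^ 2 * (cN' 3 Lc δS * cS) * Zl 4 (δS - R / 2) ^ 2))
          ((Fintype.card (Fib 3) : ℝ) ^ 2 * cW * Zl 4 (δW - R) ^ 2))
        (R * Lc)) θ :=
  (allScalesSeq_secondMoment_hessKer_dress_of_pointwise (S := fun j => (JsBal0Of hLc cE cVH cΛ W Cw' δw hδw hW' j).S) (W := W)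
    one_le_Lc hK hKall hS hSall hW hWall hR hRK hRS hRW μ ν).congr fun j => by rw [TbalOf_JsBalOf]

/-- [folklore] **THE END INSTANCE OVER `JsBalOf` — (SW1) FORM** (road A2's first half for the wall's family): `GeomRate` of
`j ↦ secondMoment (TbalOf Lc (JsBalOf …) j) μ ν` to the telescoped limit kernel's second moment
`b_∞ := secondMoment (limKernelOf (TbalOf Lc (JsBalOf …))) μ ν`, SAME `c₀ = κ`, `0 ≤ θ < 1`. -/
theorem geomRate_secondMoment_TbalOf_JsBalOf
    (hK : ∀ j, Decays (KInvStep (d := 3) Lc j) C δK)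
    (hKall : ∀ k j, Decays (KInvStep (d := 3) Lc (k + j) - KInvStep (d := 3) Lc k) (cK * θ ^ k) δK)
    (hS : ∀ j, LocStencil (JsBal0Of hLc cE cVH cΛ W Cw' δw hδw hW' j).S Cs δS)
    (hSall : ∀ k j, LocStencil ((JsBal0Of hLc cE cVH cΛ W Cw' δw hδw hW' (k + j)).S - (JsBal0Of hLc cE cVH cΛ W Cw' δw hδw hW' k).S) (cS * θ ^ k) δS)
    (hW : ∀ j, VertexFamily₂ (W j) Lc Cw δW) (hWall : ∀ k j, VertexFamily₂ (W (k + j) - W k) Lc (cW * θ ^ k) δW)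
    (hR : 0 < R) (hRK : R < δK) (hRS : R / 2 < δS) (hRW : R < δW) (hθ0 : 0 ≤ θ) (hθ1 : θ < 1) (μ ν : Fin 4) :
    GeomRate (fun j => B12Beta.secondMoment (TbalOf Lc (JsBalOf hLc cE cVH cΛ W Cw' δw hδw hW') j) μ ν)
      (B12Beta.secondMoment (limKernelOf (TbalOf Lc (JsBalOf hLc cE cVH cΛ W Cw' δw hδw hW'))) μ ν)
      (betaPrime510 4
        (lipW ((Fintype.card (Fib 3) : ℝ) * (cAx 3 Lc δK * (cAx 3 Lc δK * C)) * Zl 4 (δK - R))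
          ((Fintype.card (Fib 3) : ℝ) * (cAx 3 Lc δK * (cAx 3 Lc δK * C)) * Zl 4 (δK - R))
          ((Fintype.card (Fib 3) : ℝ) * C * Zl 4 (δK - R) * ((Fintype.card (Fib 3) : ℝ) ^ 2 * (cN' 3 Lc δS * Cs) * Zl 4 (δS - R / 2) ^ 2))
          ((Fintype.card (Fib 3) : ℝ) * C * Zl 4 (δK - R) * ((Fintype.card (Fib 3) : ℝ) ^ 2 * (cN' 3 Lc δS * Cs) * Zl 4 (δS - R / 2) ^ 2))
          ((Fintype.card (Fib 3) : ℝ) ^ 2 * Cw * Zl 4 (δW - R) ^ 2)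
          ((Fintype.card (Fib 3) : ℝ) * (cAx 3 Lc δK * (cAx 3 Lc δK * cK)) * Zl 4 (δK - R))
          ((Fintype.card (Fib 3) : ℝ) * cK * Zl 4 (δK - R) * ((Fintype.card (Fib 3) : ℝ) ^ 2 * (cN' 3 Lc δS * Cs) * Zl 4 (δS - R / 2) ^ 2) +
            (Fintype.card (Fib 3) : ℝ) * C * Zl 4 (δK - R) * ((Fintype.card (Fib 3) : ℝ) ^ 2 * (cN' 3 Lc δS * cS) * Zl 4 (δS - R / 2) ^ 2))
          ((Fintype.card (Fib 3) : ℝ) ^ 2 * cW * Zl 4 (δW - R) ^ 2))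
        (R * Lc)) θ := by
  have e : TbalOf Lc (JsBalOf hLc cE cVH cΛ W Cw' δw hδw hW') =
      fun j => hessKer (axDressK Lc (KInvStep (d := 3) Lc j))
        (axVertexOfK (KInvStep (d := 3) Lc j) Lc (JsBal0Of hLc cE cVH cΛ W Cw' δw hδw hW' j).S) (W j) :=
    funext fun j => TbalOf_JsBalOf hLc cE cVH cΛ W Cw' δw hδw hW' j
  rw [e]
  exact geomRate_secondMoment_hessKer_dress_of_pointwise (S := fun j => (JsBal0Of hLc cE cVH cΛ W Cw' δw hδw hW' j).S) (W := W)
    one_le_Lc hK hKall hS hSall hW hWall hR hRK hRS hRW hθ0 hθ1 μ ν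

/-- [folklore] **THE CONSTRUCTED LIMIT IS THE TELESCOPED LIMIT KERNEL'S SECOND MOMENT**: under the data,
`CauchyRate.lim (j ↦ secondMoment (TbalOf Lc (JsBalOf …) j) μ ν) = secondMoment (limKernelOf (TbalOf Lc (JsBalOf …))) μ ν` (uniqueness of
limits) — so `b_∞` in the identification below may be read either way. -/
theorem lim_secondMoment_TbalOf_JsBalOf
    (hK : ∀ j, Decays (KInvStep (d := 3) Lc j) C δK)
    (hKall : ∀ k j, Decays (KInvStep (d := 3) Lc (k + j) - KInvStep (d := 3) Lc k) (cK * θ ^ k) δK)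
    (hS : ∀ j, LocStencil (JsBal0Of hLc cE cVH cΛ W Cw' δw hδw hW' j).S Cs δS)
    (hSall : ∀ k j, LocStencil ((JsBal0Of hLc cE cVH cΛ W Cw' δw hδw hW' (k + j)).S - (JsBal0Of hLc cE cVH cΛ W Cw' δw hδw hW' k).S) (cS * θ ^ k) δS)
    (hW : ∀ j, VertexFamily₂ (W j) Lc Cw δW) (hWall : ∀ k j, VertexFamily₂ (W (k + j) - W k) Lc (cW * θ ^ k) δW)
    (hR : 0 < R) (hRK : R < δK) (hRS : R / 2 < δS) (hRW : R < δW) (hθ0 : 0 ≤ θ) (hθ1 : θ < 1) (μ ν : Fin 4) :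
    CauchyRate.lim (fun j => B12Beta.secondMoment (TbalOf Lc (JsBalOf hLc cE cVH cΛ W Cw' δw hδw hW') j) μ ν) =
      B12Beta.secondMoment (limKernelOf (TbalOf Lc (JsBalOf hLc cE cVH cΛ W Cw' δw hδw hW'))) μ ν :=
  have hG := geomRate_secondMoment_TbalOf_JsBalOf hLc cE cVH cΛ W Cw' δw hδw hW' hK hKall hS hSall hW hWall hR hRK hRS hRW hθ0 hθ1 μ ν
  ((hG.cauchyRate hθ0 hθ1.le).eq_lim hθ1 (hG.tendsto hθ0 hθ1)).symm

/-- [folklore] **THE WALL STATEMENT ⟺ THE EXACT IDENTIFICATION, modulo (CONV-C-Cauchy)** (road A2 in full, kernel side): under the six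
data binders and `0 ≤ θ < 1`, THE WALL'S LITERAL TERM (WALL v2.18) `OneStepKernelFamily.D1Drift Lc (JsBalOf …) N μ ν` holds IFF
`CauchyRate.lim (j ↦ secondMoment (TbalOf Lc (JsBalOf …) j) μ ν) = B12Normalization.stepBal N Lc` (equivalently, by
`lim_secondMoment_TbalOf_JsBalOf`, iff the telescoped limit kernel's second moment is `stepBal N Lc`).  (⇐): defect `A = κ/(1−θ)`;
(⇒): Cesàro.  Road A2's «second half» — the identification NOBODY has proved — is thus the whole residue of the wall once the rate
data are in.  Discharges NOTHING: every binder is a hypothesis shape. -/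
theorem d1Drift_JsBalOf_iff_lim_eq
    (hK : ∀ j, Decays (KInvStep (d := 3) Lc j) C δK)
    (hKall : ∀ k j, Decays (KInvStep (d := 3) Lc (k + j) - KInvStep (d := 3) Lc k) (cK * θ ^ k) δK)
    (hS : ∀ j, LocStencil (JsBal0Of hLc cE cVH cΛ W Cw' δw hδw hW' j).S Cs δS)
    (hSall : ∀ k j, LocStencil ((JsBal0Of hLc cE cVH cΛ W Cw' δw hδw hW' (k + j)).S - (JsBal0Of hLc cE cVH cΛ W Cw' δw hδw hW' k).S) (cS * θ ^ k) δS)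
    (hW : ∀ j, VertexFamily₂ (W j) Lc Cw δW) (hWall : ∀ k j, VertexFamily₂ (W (k + j) - W k) Lc (cW * θ ^ k) δW)
    (hR : 0 < R) (hRK : R < δK) (hRS : R / 2 < δS) (hRW : R < δW) (hθ0 : 0 ≤ θ) (hθ1 : θ < 1) (μ ν : Fin 4) (N : ℝ) :
    D1Drift Lc (JsBalOf hLc cE cVH cΛ W Cw' δw hδw hW') N μ ν ↔
      CauchyRate.lim (fun j => B12Beta.secondMoment (TbalOf Lc (JsBalOf hLc cE cVH cΛ W Cw' δw hδw hW') j) μ ν) = B12Normalization.stepBal N Lc :=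
  d1Drift_iff_lim_eq (JsBalOf hLc cE cVH cΛ W Cw' δw hδw hW')
    (allScalesSeq_secondMoment_TbalOf_JsBalOf hLc cE cVH cΛ W Cw' δw hδw hW' hK hKall hS hSall hW hWall hR hRK hRS hRW μ ν) hθ0 hθ1 N

/-- [folklore] **THE WALL FROM (CONV-C-Cauchy) + THE IDENTIFICATION OF THE TELESCOPED LIMIT** (the (⇐) direction with `b_∞` read as
`secondMoment (limKernelOf (TbalOf Lc (JsBalOf …))) μ ν`, the (SW1) limit of `AveragedAFCarrierAllScales` / road A2): `hident ⇒
D1Drift Lc (JsBalOf …) N μ ν`. -/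
theorem d1Drift_JsBalOf_of_limKernel_eq
    (hK : ∀ j, Decays (KInvStep (d := 3) Lc j) C δK)
    (hKall : ∀ k j, Decays (KInvStep (d := 3) Lc (k + j) - KInvStep (d := 3) Lc k) (cK * θ ^ k) δK)
    (hS : ∀ j, LocStencil (JsBal0Of hLc cE cVH cΛ W Cw' δw hδw hW' j).S Cs δS)
    (hSall : ∀ k j, LocStencil ((JsBal0Of hLc cE cVH cΛ W Cw' δw hδw hW' (k + j)).S - (JsBal0Of hLc cE cVH cΛ W Cw' δw hδw hW' k).S) (cS * θ ^ k) δS)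
    (hW : ∀ j, VertexFamily₂ (W j) Lc Cw δW) (hWall : ∀ k j, VertexFamily₂ (W (k + j) - W k) Lc (cW * θ ^ k) δW)
    (hR : 0 < R) (hRK : R < δK) (hRS : R / 2 < δS) (hRW : R < δW) (hθ0 : 0 ≤ θ) (hθ1 : θ < 1) (μ ν : Fin 4) {N : ℝ}
    (hident : B12Beta.secondMoment (limKernelOf (TbalOf Lc (JsBalOf hLc cE cVH cΛ W Cw' δw hδw hW'))) μ ν = B12Normalization.stepBal N Lc) :
    D1Drift Lc (JsBalOf hLc cE cVH cΛ W Cw' δw hδw hW') N μ ν :=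
  (d1Drift_JsBalOf_iff_lim_eq hLc cE cVH cΛ W Cw' δw hδw hW' hK hKall hS hSall hW hWall hR hRK hRS hRW hθ0 hθ1 μ ν N).2
    ((lim_secondMoment_TbalOf_JsBalOf hLc cE cVH cΛ W Cw' δw hδw hW' hK hKall hS hSall hW hWall hR hRK hRS hRW hθ0 hθ1 μ ν).trans hident)

end Wall

/-! ## §5 β-level corollaries over `JsBalOf` (asym2's all-scales × constant sockets BY NAME; the cap slot = certified finite-`k` values) -/

section Beta

open FlowStep DagBinding FlowStepRuns
open Literature.MathematicalPhysics.QuantumFieldTheory.Balaban1983to89.Beta.Assembly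
open Literature.MathematicalPhysics.QuantumFieldTheory.Balaban1983to89.Beta.RemainderChain (RemainderConst)

variable {β : HBeta} {Lc : ℕ} [NeZero Lc] (hLc : 1 ≤ Lc) (cE cVH cΛ : ℝ)
  (W : ℕ → Fin (3 + 1) → (Fin (3 + 1) → ℤ) → Fin (3 + 1) → (Fin (3 + 1) → ℤ) → MKer (3 + 1) (Fib 3))
  (Cw' δw : ℕ → ℝ) (hδw : ∀ j, 0 < δw j) (hW' : ∀ j, VertexFamily₂ (W j) Lc (Cw' j) (δw j))
  {R C cK δK Cs cS δS Cw cW δW θ : ℝ}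

/-- [folklore] **`β⁰_k > 0` FOR EVERY `k ≥ k₀` FROM ONE CERTIFIED VALUE AT `k₀`** (the lane's `betaBar_pos_of_ge k₀` in the wall's currency):
with `Sβ.β0 j = secondMoment (TbalOf Lc (JsBalOf …) j) μ ν` (`hβ0`), an all-scales bound `hall` of those coefficients (explicit `κ` from
`allScalesSeq_secondMoment_TbalOf_JsBalOf`, or any other supplier), ONE certified lower value `m ≤ β⁰_{k₀}` (cap lanes) and the ONE numeric
gap `κθ^{k₀} < m`: `∀ k ≥ k₀, 0 < Sβ.β0 k`.  The agreed `k₀` is whatever level the cap lanes certify `m` at; no θ-range, no limit, no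
identification. -/
theorem beta0_pos_of_ge_JsBalOf (Sβ : B12Beta.OneLoopSplit β) {μ ν : Fin 4} {κ θ : ℝ}
    (hβ0 : ∀ j, Sβ.β0 j = B12Beta.secondMoment (TbalOf Lc (JsBalOf hLc cE cVH cΛ W Cw' δw hδw hW') j) μ ν)
    (hall : AllScalesSeq (fun j => B12Beta.secondMoment (TbalOf Lc (JsBalOf hLc cE cVH cΛ W Cw' δw hδw hW') j) μ ν) κ θ)
    {k₀ : ℕ} {m : ℝ} (hm : m ≤ Sβ.β0 k₀) (hgap : κ * θ ^ k₀ < m) : ∀ k, k₀ ≤ k → 0 < Sβ.β0 k :=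
  pos_of_ge (hall.congr hβ0) hm hgap

/-- [folklore] **ALL ONE-LOOP COEFFICIENTS OF THE WALL'S FAMILY ARE POSITIVE from an all-scales bound + a ONE-SIDED certified list**
`m ≤ β⁰_j` (`j ≤ k₁`) and the gap `κθ^{k₁} < m` (asym2's `AllScalesSeq.pos_all_of_list` BY NAME). -/
theorem beta0_pos_all_JsBalOf (Sβ : B12Beta.OneLoopSplit β) {μ ν : Fin 4} {κ θ : ℝ}
    (hβ0 : ∀ j, Sβ.β0 j = B12Beta.secondMoment (TbalOf Lc (JsBalOf hLc cE cVH cΛ W Cw' δw hδw hW') j) μ ν)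
    (hall : AllScalesSeq (fun j => B12Beta.secondMoment (TbalOf Lc (JsBalOf hLc cE cVH cΛ W Cw' δw hδw hW') j) μ ν) κ θ)
    {k₁ : ℕ} {m : ℝ} (hlist : ∀ j, j ≤ k₁ → m ≤ Sβ.β0 j) (hgap : κ * θ ^ k₁ < m) : ∀ j, 0 < Sβ.β0 j :=
  (hall.congr hβ0).pos_all_of_list hlist hgap

/-- [folklore] **THEOREM 2 AS PRINTED ((0.31) p. 259) OVER THE WALL'S FAMILY on the all-scales × constant road, (U) DERIVED** — asym2's
`RemainderConstAllScales.thm2Printed_of_allScalesConst_cont` over `JsBalOf`: binders DAG, `1 < L`, `Sβ`, `hβ0`, the all-scales bound `hall`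
(explicit `κ`: `allScalesSeq_secondMoment_TbalOf_JsBalOf` under (CONV-C-Cauchy)), the one-sided certified list, `RemainderConst Sβ γ₀ r`
((D4), an4/asym2), the ONE condition `r < m − κθ^{k₁}`, (C).  Discharges NOTHING: every binder is a hypothesis.
[cite: Balaban1987RG1, Thm 2 p.259 with (0.31)] -/
theorem thm2Printed_JsBalOf_of_allScalesConst_cont {Cn : B12.Construction} (hgen : ForwardGenerated Cn β) {L : ℝ} (hL : 1 < L)
    (Sβ : B12Beta.OneLoopSplit β) {μ ν : Fin 4} {κ θ : ℝ}
    (hβ0 : ∀ j, Sβ.β0 j = B12Beta.secondMoment (TbalOf Lc (JsBalOf hLc cE cVH cΛ W Cw' δw hδw hW') j) μ ν)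
    (hall : AllScalesSeq (fun j => B12Beta.secondMoment (TbalOf Lc (JsBalOf hLc cE cVH cΛ W Cw' δw hδw hW') j) μ ν) κ θ)
    {γ₀ r m : ℝ} {k₁ : ℕ} (hγ₀ : 0 < γ₀) (hlist : ∀ j, j ≤ k₁ → m ≤ Sβ.β0 j) (hrem : RemainderConst Sβ γ₀ r)
    (hr : r < m - κ * θ ^ k₁) (hcont : BetaContH γ₀ β) : B12.Thm2Printed Cn L :=
  RemainderConstAllScales.thm2Printed_of_allScalesConst_cont hgen hL Sβ hγ₀ (hall.congr hβ0) hlist hrem hr hcont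

/-- [folklore] **END `EndpointExistence` OVER THE WALL'S FAMILY, all-scales × constant, (U) DERIVED** (asym2's
`endpointExistence_of_allScalesConst_cont` BY NAME). [cite: Balaban1987RG1, Thm 2 p.259 (first sentence)] -/
theorem endpointExistence_JsBalOf_of_allScalesConst_cont {Cn : B12.Construction} (hgen : ForwardGenerated Cn β)
    (Sβ : B12Beta.OneLoopSplit β) {μ ν : Fin 4} {κ θ : ℝ}
    (hβ0 : ∀ j, Sβ.β0 j = B12Beta.secondMoment (TbalOf Lc (JsBalOf hLc cE cVH cΛ W Cw' δw hδw hW') j) μ ν)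
    (hall : AllScalesSeq (fun j => B12Beta.secondMoment (TbalOf Lc (JsBalOf hLc cE cVH cΛ W Cw' δw hδw hW') j) μ ν) κ θ)
    {γ₀ r m : ℝ} {k₁ : ℕ} (hγ₀ : 0 < γ₀) (hlist : ∀ j, j ≤ k₁ → m ≤ Sβ.β0 j) (hrem : RemainderConst Sβ γ₀ r)
    (hr : r < m - κ * θ ^ k₁) (hcont : BetaContH γ₀ β) : EndpointExistence Cn :=
  RemainderConstAllScales.endpointExistence_of_allScalesConst_cont hgen Sβ hγ₀ (hall.congr hβ0) hlist hrem hr hcont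

/-- [folklore] **JOINED END** (the two halves in one statement, for the record): DAG, `1 < L`, `Sβ`, `hβ0`, THE SIX (CONV-C-Cauchy) DATA
BINDERS with target rate, the certified list, (D4), the one numeric condition with the EXPLICIT `κ`, (C) ⟹ `B12.Thm2Printed Cn L`. -/
theorem thm2Printed_JsBalOf_of_pointwise_cont {Cn : B12.Construction} (hgen : ForwardGenerated Cn β) {L : ℝ} (hL : 1 < L)
    (Sβ : B12Beta.OneLoopSplit β) {μ ν : Fin 4}
    (hβ0 : ∀ j, Sβ.β0 j = B12Beta.secondMoment (TbalOf Lc (JsBalOf hLc cE cVH cΛ W Cw' δw hδw hW') j) μ ν)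
    (hK : ∀ j, Decays (KInvStep (d := 3) Lc j) C δK)
    (hKall : ∀ k j, Decays (KInvStep (d := 3) Lc (k + j) - KInvStep (d := 3) Lc k) (cK * θ ^ k) δK)
    (hS : ∀ j, LocStencil (JsBal0Of hLc cE cVH cΛ W Cw' δw hδw hW' j).S Cs δS)
    (hSall : ∀ k j, LocStencil ((JsBal0Of hLc cE cVH cΛ W Cw' δw hδw hW' (k + j)).S - (JsBal0Of hLc cE cVH cΛ W Cw' δw hδw hW' k).S) (cS * θ ^ k) δS)
    (hW : ∀ j, VertexFamily₂ (W j) Lc Cw δW) (hWall : ∀ k j, VertexFamily₂ (W (k + j) - W k) Lc (cW * θ ^ k) δW)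
    (hR : 0 < R) (hRK : R < δK) (hRS : R / 2 < δS) (hRW : R < δW)
    {γ₀ r m : ℝ} {k₁ : ℕ} (hγ₀ : 0 < γ₀) (hlist : ∀ j, j ≤ k₁ → m ≤ Sβ.β0 j) (hrem : RemainderConst Sβ γ₀ r)
    (hr : r < m -
        (betaPrime510 4
          (lipW ((Fintype.card (Fib 3) : ℝ) * (cAx 3 Lc δK * (cAx 3 Lc δK * C)) * Zl 4 (δK - R))
            ((Fintype.card (Fib 3) : ℝ) * (cAx 3 Lc δK * (cAx 3 Lc δK * C)) * Zl 4 (δK - R))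
            ((Fintype.card (Fib 3) : ℝ) * C * Zl 4 (δK - R) * ((Fintype.card (Fib 3) : ℝ) ^ 2 * (cN' 3 Lc δS * Cs) * Zl 4 (δS - R / 2) ^ 2))
            ((Fintype.card (Fib 3) : ℝ) * C * Zl 4 (δK - R) * ((Fintype.card (Fib 3) : ℝ) ^ 2 * (cN' 3 Lc δS * Cs) * Zl 4 (δS - R / 2) ^ 2))
            ((Fintype.card (Fib 3) : ℝ) ^ 2 * Cw * Zl 4 (δW - R) ^ 2)
            ((Fintype.card (Fib 3) : ℝ) * (cAx 3 Lc δK * (cAx 3 Lc δK * cK)) * Zl 4 (δK - R))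
            ((Fintype.card (Fib 3) : ℝ) * cK * Zl 4 (δK - R) * ((Fintype.card (Fib 3) : ℝ) ^ 2 * (cN' 3 Lc δS * Cs) * Zl 4 (δS - R / 2) ^ 2) +
              (Fintype.card (Fib 3) : ℝ) * C * Zl 4 (δK - R) * ((Fintype.card (Fib 3) : ℝ) ^ 2 * (cN' 3 Lc δS * cS) * Zl 4 (δS - R / 2) ^ 2))
            ((Fintype.card (Fib 3) : ℝ) ^ 2 * cW * Zl 4 (δW - R) ^ 2))
          (R * Lc)) * θ ^ k₁)
    (hcont : BetaContH γ₀ β) : B12.Thm2Printed Cn L :=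
  thm2Printed_JsBalOf_of_allScalesConst_cont hLc cE cVH cΛ W Cw' δw hδw hW' hgen hL Sβ hβ0
    (allScalesSeq_secondMoment_TbalOf_JsBalOf hLc cE cVH cΛ W Cw' δw hδw hW' hK hKall hS hSall hW hWall hR hRK hRS hRW μ ν) hγ₀ hlist hrem hr hcont

end Beta

end Literature.MathematicalPhysics.QuantumFieldTheory.Balaban1983to89.Beta.HessKerDressedCauchy
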